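import Literature.NumberTheory.Automorphic.QuadraticHeckeCharacter
import Literature.NumberTheory.Automorphic.QuaternionRamificationParityHolds
import Literature.NumberTheory.Automorphic.BookerKrishnamurthyConverse
import HarnessLib

/-!
# The archimedean components of the quadratic Hecke character `ω_{F(√θ)/F}` are the Hilbert symbols `( · , θ)_w`

Topic `NumberTheory/Automorphic`; namespace `Literature.NumberTheory.Automorphic`. Everything here is proved; this
is the infinite-place twin of `QuadraticHeckeCharacterLocalComponent.lean`.

For a number field `K`, a non-square `θ ∈ 𝓞 K` and the quadratic Hecke character `ω = quadraticHeckeChar K θ`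
(the sign character of `P_K · N_{K(√θ)/K} J = principalIdeles K ⊔ normIdeles K θ`, O'Meara 65:21), and an
infinite place `w` with the idèle `⟨c⟩_w = infiniteIdeleSingle w c` (`c ∈ K_wˣ` at `w`, `1` elsewhere;
`BookerKrishnamurthyConverse.lean`, where `ω.archComponent w = ω ∘ ⟨·⟩_w`):

* `ideleInfiniteComponent_infiniteIdeleSingle_self/_of_ne`, `ideleFiniteComponent_infiniteIdeleSingle` — the
  components of `⟨c⟩_w` in the vocabulary of `QuadraticNormIndex.lean`;
* `infiniteIdeleSingle_mem_normIdeles_iff` — `⟨c⟩_w` is a norm idèle iff `c` is a local norm at `w`;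
* `infiniteIdeleSingle_mem_principalIdeles_sup_normIdeles_iff` — **`⟨c⟩_w ∈ P_K · N J ↔ c ∈ N(K_w(√θ)ˣ)`**
  ("→" by Hilbert's reciprocity law `hilbertReciprocity_holds`: a `γ` read off `⟨c⟩_w = (γ)·n` would have
  `(γ, θ)_𝔭 = -1` exactly at `𝔭 = w`, an odd number of places);
* `quadraticHeckeChar_infiniteIdeleSingle` / `archComponent_quadraticHeckeChar` — **`ω(⟨c⟩_w) = (c, θ)_w`**:
  at a complex place `1`; at a real place `w`, `-1` iff `w(θ) < 0` and `c < 0` (the Hilbert symbol of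
  `K_w = ℝ`), i.e. `ω_w = sgn` at the real places ramified in `K(√θ)` and `ω_w = 1` at the others.

Provenance: tree-vocabulary form of the `pub-hodgecm` package theorems
`NumberField.infIdeleSingle_mem_quadraticNormGroup_iff` / `coe_quadraticCharacter_infIdeleSingle`
(`HodgeCM/Literature/QuadraticCharacterLocal.lean`, gen 6, gate run 27) and `quadraticCharacter_single_of_isReal`
(`QuadraticCharacter.lean`), re-proved over the tree's `quadraticHeckeChar`.

## References

* O. T. O'Meara, *Introduction to Quadratic Forms*, Grundlehren 117 (1963), §65A (Example 65:2), §65D Prop. 65:21,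
  §71D Thm. 71:18 and proof of Thm. 71:19. [Omeara1963]
* J. Tate, *Global class field theory*, in Cassels–Fröhlich (1967), Ch. VII §6. [CasselsFrohlichANT1967]
-/

noncomputable section

open scoped NumberField
open NumberField IsDedekindDomain

namespace Literature.NumberTheory.Automorphic

open QuadraticForms GaloisRepresentations

variable (K : Type) [Field K] [NumberField K]

/-! ### Components of the `w`-idèle `⟨c⟩_w` -/

/-- `⟨c⟩_w` has component `c` at `w`. [folklore] -/
@[simp]
theorem ideleInfiniteComponent_infiniteIdeleSingle_self (w : InfinitePlace K) (c : (w.Completion)ˣ) :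
    ideleInfiniteComponent K w (infiniteIdeleSingle w c) = c :=
  Units.ext (infiniteIdeleSingle_fst_self w c)

/-- `⟨c⟩_w` has component `1` at an infinite place `w' ≠ w`. [folklore] -/
theorem ideleInfiniteComponent_infiniteIdeleSingle_of_ne {w w' : InfinitePlace K} (c : (w.Completion)ˣ)
    (h : w' ≠ w) : ideleInfiniteComponent K w' (infiniteIdeleSingle w c) = 1 :=
  Units.ext (infiniteIdeleSingle_fst_of_ne c h)

/-- `⟨c⟩_w` has component `1` at every finite place. [folklore] -/
@[simp]
theorem ideleFiniteComponent_infiniteIdeleSingle (w : InfinitePlace K) (c : (w.Completion)ˣ)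
    (v : HeightOneSpectrum (𝓞 K)) : ideleFiniteComponent K v (infiniteIdeleSingle w c) = 1 := by
  apply Units.ext
  rw [val_ideleFiniteComponent, infiniteIdeleSingle_snd]
  rfl

/-- `⟨c⟩_w` is a norm idèle of `K(√θ)/K` iff `c` is a local norm at `w`: all other components are `1`.
[folklore] -/
theorem infiniteIdeleSingle_mem_normIdeles_iff (θ : K) (w : InfinitePlace K) (c : (w.Completion)ˣ) :
    infiniteIdeleSingle w c ∈ normIdeles K θ ↔
      c ∈ quadraticNormSubgroup w.Completion (algebraMap K _ θ) := by
  rw [mem_normIdeles_iff_forall_isLocalNormAt]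
  constructor
  · intro h
    have hw := h (Sum.inr w)
    rwa [isLocalNormAt_inr, ideleInfiniteComponent_infiniteIdeleSingle_self] at hw
  · intro hc p
    cases p with
    | inl v => rw [isLocalNormAt_inl, ideleFiniteComponent_infiniteIdeleSingle]; exact one_mem _
    | inr w' =>
      rw [isLocalNormAt_inr]
      by_cases hw' : w' = w
      · subst hw'; rwa [ideleInfiniteComponent_infiniteIdeleSingle_self]
      · rw [ideleInfiniteComponent_infiniteIdeleSingle_of_ne K c hw']; exact one_mem _

/-- **`⟨c⟩_w ∈ P_K · N_{K(√θ)/K} J ↔ c` is a local norm at the infinite place `w`** (`θ ≠ 0`); "→" by Hilbert's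
reciprocity law (O'Meara 71:18, `hilbertReciprocity_holds`). [cite: Omeara1963, §71D Thm. 71:18 and proof of Thm. 71:19] -/
theorem infiniteIdeleSingle_mem_principalIdeles_sup_normIdeles_iff {θ : K} (hθ0 : θ ≠ 0)
    (w : InfinitePlace K) (c : (w.Completion)ˣ) :
    infiniteIdeleSingle w c ∈ principalIdeles K ⊔ normIdeles K θ ↔
      c ∈ quadraticNormSubgroup w.Completion (algebraMap K _ θ) := by
  classical
  refine ⟨fun hmem ↦ ?_, fun hc ↦ Subgroup.mem_sup_right ((infiniteIdeleSingle_mem_normIdeles_iff K θ w c).2 hc)⟩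
  by_contra hcN
  obtain ⟨γ, hγ⟩ := exists_placeSymbol_eq_neg_one_iff_of_mem_sup hθ0 hmem
  have hbad : badPlaces (γ : K) θ = {Sum.inr w} := by
    ext p
    rw [mem_badPlaces_iff, hγ, Set.mem_singleton_iff]
    cases p with
    | inl v =>
      rw [isLocalNormAt_inl, ideleFiniteComponent_infiniteIdeleSingle]
      simp only [one_mem, not_true_eq_false, reduceCtorEq]
    | inr w' =>
      rw [isLocalNormAt_inr]
      by_cases hw' : w' = w
      · subst hw'
        rw [ideleInfiniteComponent_infiniteIdeleSingle_self]
        exact ⟨fun _ ↦ rfl, fun _ ↦ hcN⟩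
      · rw [ideleInfiniteComponent_infiniteIdeleSingle_of_ne K c hw']
        simp only [one_mem, not_true_eq_false, Sum.inr.injEq, hw']
  have hcard := ncard_badPlaces (K := K) γ.ne_zero hθ0
  rw [hbad, Set.ncard_singleton] at hcard
  have heven := (hilbertReciprocity_holds K (γ : K) θ γ.ne_zero hθ0).2
  rw [← hcard] at heven
  exact Nat.not_even_one heven

variable {K}

/-- `ω(⟨c⟩_w) = 1 ↔ c` is a local norm at `w`. [cite: Omeara1963, §65A and §71D proof of Thm. 71:19] -/
theorem quadraticHeckeChar_infiniteIdeleSingle_eq_one_iff_mem {θ : 𝓞 K} (hθ : ¬ IsSquare (θ : K))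
    (w : InfinitePlace K) (c : (w.Completion)ˣ) :
    quadraticHeckeChar K θ hθ (infiniteIdeleSingle w c) = 1 ↔
      c ∈ quadraticNormSubgroup w.Completion (algebraMap K _ (θ : K)) := by
  have hθ0 : (θ : K) ≠ 0 := by exact_mod_cast RingOfIntegers.ne_zero_of_not_isSquare K hθ
  rw [← infiniteIdeleSingle_mem_principalIdeles_sup_normIdeles_iff K hθ0 w c]
  constructor
  · intro h
    by_contra hn
    have h' := quadraticHeckeChar_apply_of_not_mem hθ hn
    rw [h] at h'
    exact absurd (Units.ext_iff.1 h') (by norm_num)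
  · exact quadraticHeckeChar_apply_of_mem hθ

/-- **The archimedean components of the quadratic Hecke character are the Hilbert symbols**:
`ω(⟨c⟩_w) = (c, θ)_w` for every infinite place `w` and `c ∈ K_wˣ`. [cite: Omeara1963, §71D proof of Thm. 71:19] -/
theorem quadraticHeckeChar_infiniteIdeleSingle {θ : 𝓞 K} (hθ : ¬ IsSquare (θ : K))
    (w : InfinitePlace K) (c : (w.Completion)ˣ) :
    ((quadraticHeckeChar K θ hθ (infiniteIdeleSingle w c) : ℂˣ) : ℂ) =
      (hilbertSymbol w.Completion (c : w.Completion) (algebraMap K _ (θ : K)) : ℂ) := by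
  haveI : CharZero w.Completion := charZero_of_injective_algebraMap (algebraMap K w.Completion).injective
  have hθ0 : (θ : K) ≠ 0 := by exact_mod_cast RingOfIntegers.ne_zero_of_not_isSquare K hθ
  have hθw : algebraMap K w.Completion (θ : K) ≠ 0 := (_root_.map_ne_zero _).2 hθ0
  by_cases hc : c ∈ quadraticNormSubgroup w.Completion (algebraMap K _ (θ : K))
  · rw [(quadraticHeckeChar_infiniteIdeleSingle_eq_one_iff_mem hθ w c).2 hc,
      (hilbertSymbol_eq_one_iff_mem_quadraticNormSubgroup hθw c).2 hc, Units.val_one, Int.cast_one]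
  · have hmem : infiniteIdeleSingle w c ∉ principalIdeles K ⊔ normIdeles K (θ : K) :=
      fun h ↦ hc ((infiniteIdeleSingle_mem_principalIdeles_sup_normIdeles_iff K hθ0 w c).1 h)
    rw [quadraticHeckeChar_apply_of_not_mem hθ hmem,
      (hilbertSymbol_eq_neg_one_iff_not_mem_quadraticNormSubgroup hθw c).2 hc, Units.val_neg, Units.val_one,
      Int.cast_neg, Int.cast_one]

/-- The same for the bundled archimedean component `ω_w = ω.archComponent w : K_wˣ →* ℂˣ`.
[cite: Omeara1963, §71D proof of Thm. 71:19] -/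
theorem archComponent_quadraticHeckeChar {θ : 𝓞 K} (hθ : ¬ IsSquare (θ : K))
    (w : InfinitePlace K) (c : (w.Completion)ˣ) :
    (((quadraticHeckeChar K θ hθ).archComponent w c : ℂˣ) : ℂ) =
      (hilbertSymbol w.Completion (c : w.Completion) (algebraMap K _ (θ : K)) : ℂ) := by
  rw [HeckeCharacter.archComponent_apply, quadraticHeckeChar_infiniteIdeleSingle]

end Literature.NumberTheory.Automorphic

end
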